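import Summits.KontsevichZagierPeriods.KontsevichZagierPeriods.Theorems.LinRedNormalFormArrangementNormalFormSeparateTwoWindow
import Summits.KontsevichZagierPeriods.KontsevichZagierPeriods.Theorems.LinRedNormalFormArrangementNormalFormSeparateTwoShift

/-!
# Adapters: the concrete window contractions and shifts discharge the abstract hypotheses

(Line `janus-bands`, crux `ArrangementNormalForm`, stub `stub_separateTwo`, part `Adapters`.)
The multi-cluster lemmas of parts `Generic` (`SepTwo.lmass_perturb`) and `Contract`
(`SepTwo.lmass_contract`, `SepTwo.lmass_perturb_clusters`) consume the single-window maps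
abstractly, through hypotheses `hshift` / `hwin` of a fixed `∃ ψ ψ' B, …` shape. This file
discharges those shapes from `separateTwo_shift` (part `Shift`) and `separateTwo_window` (part
`Window`): `hshift_of_shift` (core `ℓ`, window `ρ`, `|δ| ≤ (ρ−ℓ)/2`), `hshift_of_gap` (the
`g/8, g/4, g/16` calibration of `lmass_perturb`, the identity when `g ≤ 0`), and `hwin_of_window`
(contraction factor `s`, constant `A = 3 · SepTwo.wexp ℓ ρ s`; registered as
`separateTwo_adapters`).
-/

noncomputable section

open Set

namespace Summit.KontsevichZagierPeriods.ArrangementNormalForm.JanusBands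

namespace SepTwo

/-- The break points of a window centred at `m` with radii `ℓ, ρ`. -/
def breaks (m ℓ ρ : ℝ) : Finset ℝ := {m - ρ, m - ℓ, m + ℓ, m + ρ}

/-- Off the break points, `|x − m| ∉ {ℓ, ρ}`. -/
theorem abs_ne_of_not_mem_breaks {m ℓ ρ x : ℝ} (hx : x ∉ (breaks m ℓ ρ : Set ℝ)) :
    |x - m| ≠ ℓ ∧ |x - m| ≠ ρ := by
  simp only [breaks, Finset.coe_insert, Finset.coe_singleton, mem_insert_iff,
    mem_singleton_iff, not_or] at hx
  obtain ⟨h1, h2, h3, h4⟩ := hx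
  refine ⟨fun h => ?_, fun h => ?_⟩
  · rcases (abs_eq (h ▸ abs_nonneg (x - m))).1 h with h' | h'
    · exact h3 (by linarith)
    · exact h2 (by linarith)
  · rcases (abs_eq (h ▸ abs_nonneg (x - m))).1 h with h' | h'
    · exact h4 (by linarith)
    · exact h1 (by linarith)

/-- **Shifts discharge `hshift`** (shape of `SepTwo.lmass_perturb_clusters`). -/
theorem hshift_of_shift {ℓ ρ : ℝ} (hℓ : 0 < ℓ) (hρ : ℓ < ρ) (m δ : ℝ) (hδ : |δ| ≤ (ρ - ℓ) / 2) :
    ∃ (ψ ψ' : ℝ → ℝ) (B : Finset ℝ), StrictMono ψ ∧ Function.Surjective ψ ∧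
      (∀ x, x ∉ (B : Set ℝ) → HasDerivAt ψ (ψ' x) x) ∧ (∀ x, 0 ≤ ψ' x ∧ ψ' x ≤ 3) ∧
      (∀ x γ, ψ' x * |x - γ| ≤ 3 * |ψ x - ψ γ|) ∧
      (∀ x, |x - m| ≤ ℓ → ψ x = x + δ) ∧ (∀ x, ρ ≤ |x - m| → ψ x = x) := by
  obtain ⟨hmono, hsurj, hder, hbd, hrat, hcore, hfar⟩ := separateTwo_shift m ℓ ρ δ hℓ hρ hδ
  refine ⟨smap m ℓ ρ δ, smapD m ℓ ρ δ, breaks m ℓ ρ, hmono, hsurj, fun x hx => ?_, fun x => ?_,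
    hrat, hcore, hfar⟩
  · obtain ⟨h1, h2⟩ := abs_ne_of_not_mem_breaks hx
    exact hder x h1 h2
  · obtain ⟨h1, h2⟩ := hbd x
    exact ⟨by linarith, by linarith⟩

/-- **Shifts discharge `hshift`** (the `g/8, g/4, g/16` calibration of `SepTwo.lmass_perturb`). -/
theorem hshift_of_gap (g m δ : ℝ) (hδ : |δ| ≤ g / 16) :
    ∃ (ψ ψ' : ℝ → ℝ) (B : Finset ℝ), StrictMono ψ ∧ Function.Surjective ψ ∧
      (∀ x, x ∉ (B : Set ℝ) → HasDerivAt ψ (ψ' x) x) ∧ (∀ x, 0 ≤ ψ' x ∧ ψ' x ≤ 3) ∧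
      (∀ x γ, ψ' x * |x - γ| ≤ 3 * |ψ x - ψ γ|) ∧
      (∀ x, |x - m| ≤ g / 8 → ψ x = x + δ) ∧ (∀ x, g / 4 ≤ |x - m| → ψ x = x) := by
  by_cases hg : 0 < g
  · exact hshift_of_shift (ℓ := g / 8) (ρ := g / 4) (by positivity) (by linarith) m δ
      (by linarith)
  · have hδ0 : δ = 0 := abs_eq_zero.1 (le_antisymm (hδ.trans (by linarith)) (abs_nonneg δ))
    refine ⟨id, fun _ => 1, ∅, strictMono_id, Function.surjective_id, fun x _ => hasDerivAt_id x,
      fun x => ⟨zero_le_one, by norm_num⟩, fun x γ => ?_, fun x _ => by simp [hδ0], fun x _ => rfl⟩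
    simp only [id, one_mul]
    linarith [abs_nonneg (x - γ)]

/-- **Window contractions discharge `hwin`** (shape of `SepTwo.lmass_contract`). -/
theorem hwin_of_window {ℓ ρ s : ℝ} (hℓ : 0 < ℓ) (hρ : 2 * ℓ ≤ ρ) (hs0 : 0 < s) (hs1 : s ≤ 1)
    (m : ℝ) :
    ∃ (ψ ψ' : ℝ → ℝ) (B : Finset ℝ), StrictMono ψ ∧ Function.Surjective ψ ∧
      (∀ x, x ∉ (B : Set ℝ) → HasDerivAt ψ (ψ' x) x) ∧
      (∀ x, 0 ≤ ψ' x ∧ ψ' x ≤ 3 * wexp ℓ ρ s) ∧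
      (∀ x γ, x ∉ (B : Set ℝ) → (|γ - m| ≤ ℓ / 2 ∨ 3 * ρ ≤ |γ - m|) →
        ψ' x * |x - γ| ≤ 3 * wexp ℓ ρ s * |ψ x - ψ γ|) ∧
      (∀ x, |x - m| ≤ ℓ → ψ x = m + s * (x - m)) ∧ (∀ x, ρ ≤ |x - m| → ψ x = x) := by
  obtain ⟨hmono, hsurj, hder, hbd, hrat, hcore, hfar, hone⟩ :=
    separateTwo_window m ℓ ρ s hℓ hρ hs0 hs1
  refine ⟨wmap m ℓ ρ s, wmapD m ℓ ρ s, breaks m ℓ ρ, hmono, hsurj, fun x hx => ?_, fun x => ?_,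
    fun x γ hx hγ => ?_, hcore, hfar⟩
  · obtain ⟨h1, h2⟩ := abs_ne_of_not_mem_breaks hx
    exact hder x h1 h2
  · obtain ⟨h1, h2⟩ := hbd x
    exact ⟨h1, by nlinarith⟩
  · obtain ⟨h1, h2⟩ := abs_ne_of_not_mem_breaks hx
    exact hrat x γ h1 h2 hγ

end SepTwo

/-- **Window contractions discharge the abstract hypothesis `hwin` of the contraction lemma**
(registered sub-goal of `stub_separateTwo`; literal form of `SepTwo.hwin_of_window`). -/
theorem separateTwo_adapters (ℓ ρ s : ℝ) (hℓ : 0 < ℓ) (hρ : 2 * ℓ ≤ ρ) (hs0 : 0 < s) (hs1 : s ≤ 1) (m : ℝ) : ∃ (ψ ψ' : ℝ → ℝ) (B : Finset ℝ), StrictMono ψ ∧ Function.Surjective ψ ∧ (∀ x, x ∉ (B : Set ℝ) → HasDerivAt ψ (ψ' x) x) ∧ (∀ x, 0 ≤ ψ' x ∧ ψ' x ≤ 3 * SepTwo.wexp ℓ ρ s) ∧ (∀ x γ, x ∉ (B : Set ℝ) → (|γ - m| ≤ ℓ / 2 ∨ 3 * ρ ≤ |γ - m|) → ψ' x * |x -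 γ| ≤ 3 * SepTwo.wexp ℓ ρ s * |ψ x - ψ γ|) ∧ (∀ x, |x - m| ≤ ℓ → ψ x = m + s * (x - m)) ∧ (∀ x, ρ ≤ |x - m| → ψ x = x) := by
  exact SepTwo.hwin_of_window hℓ hρ hs0 hs1 m

end Summit.KontsevichZagierPeriods.ArrangementNormalForm.JanusBands
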